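import Summits.BirchSwinnertonDyer.BirchSwinnertonDyer.Theses.KatoDescentTamePotSupersingular
import Summits.BirchSwinnertonDyer.BirchSwinnertonDyer.Theorems.KatoDescentTamePotSupersingularTameCoatesSujathaResidueOfKatoZetaLine
import HarnessLib

/-!
# Route `KatoDescentTamePotSupersingular` (rung K8-t′, cell `bsd-potss`): CLOSER of the generated split glue
# `TameCoatesSujathaResidueOfKatoZeta : HeldKatoZetaBodyInputs → TameKatoZetaIndivisible → TameCoatesSujathaResidue`
# (plan g25 split of item 19916, kit k9-c4 g15) — one term over the landed helper p593210

Seat `bsd-potss-k9-c4` g15 (courtesy for the KT lane).  File it `--workitem <KT glue item id>` once the planner's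
`--split TameCoatesSujathaResidue --into children_KT.json --glue-decl-name TameCoatesSujathaResidueOfKatoZeta` has
landed.  HONEST FRAMING: closes a GLUE item only; 19916's open content becomes the crux child `TameKatoZetaIndivisible`;
BSD is not advanced; nothing is booked.
-/

-- the summit and its single problem are both named `BirchSwinnertonDyer` (registry layout D-0017)
set_option linter.dupNamespace false
set_option autoImplicit false

namespace Summit.BirchSwinnertonDyer.BirchSwinnertonDyer.Theorems

/-- **The split glue `TameCoatesSujathaResidueOfKatoZeta` holds** (children ⟹ parent), by the landed conditional
closer-helper `tameCoatesSujathaResidue_of_katoZetaBodyInputs_of_katoZetaMultiple` (k9-c4 g15, p593210).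
[cite: Kato2004Asterisque, Ex. 13.3 (p. 225), Thm. 12.5 (1) (pp. 221–222), Thm. 13.4 (p. 226)] [cite: CoatesSujatha2005, Conjecture A] -/
theorem tameCoatesSujathaResidueOfKatoZeta_proof :
    Summit.BirchSwinnertonDyer.BirchSwinnertonDyer.Theses.KatoDescentTamePotSupersingular.TameCoatesSujathaResidueOfKatoZeta :=
  fun h1 h2 => tameCoatesSujathaResidue_of_katoZetaBodyInputs_of_katoZetaMultiple h1 h2

end Summit.BirchSwinnertonDyer.BirchSwinnertonDyer.Theorems
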